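import Literature.MathematicalPhysics.QuantumFieldTheory.Balaban1983to89.B11Eq80CurrentRealSubspace
import Summits.QuantumFields.YangMills.Theorems.UnitScaleTiltProp7SectET3WCurrentRealityLettersT3
import Summits.QuantumFields.YangMills.Theorems.UnitScaleTiltProp7HfRealityTrace
import Summits.QuantumFields.YangMills.Theorems.UnitScaleTiltProp7SectET3JcurReality
import HarnessLib

/-!
# Route `UnitScaleTilt`, crux K1 child «MinimiserStabilityRegPr» (stmt-QuantumFields-19200), stub `stub_existenceMinimalOrbit` (EX), route (α) — THE (W-X′) INSTANTIATION OF THE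
# DISPLAY'S `Wf`: **THE REALITY ROW `hWR` AT `Wf := W80 ρ₂ τ₂ (bgOfCfg F K U₀) H̃ C̃ εC (Jcur (bgOfCfg F K U₀)) Δ̃π` FROM ITS LOCATED RESIDUE** — a DOOR over lit ✓`W80_apply_mem` with `hH hC hJ`,
# the duality rows and BOTH scalar-sector rows `hDZ hD3Z` DISCHARGED; displayed: the Sect. C regime, `Prop4Hyp C̃`, the sector row of `Δ̃π`, the CENTRAL INVARIANCE of `C̃` (Z-C), and the
# V₀-group current's sector row (R-V₀)

Cell `ym3-torus`, width seat `ym3-torus-px3` (gen 3; LOCATE «HWR-AT-W80» `ym3-torus-px3/g3/LOCATE-HWR-W80-px3g3.md` §§0–3).  THEOREMS ONLY (0 `def`, 0 `sorry`); `--supports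
stmt-QuantumFields-19200 --as helper`; count-neutral.  YM₃ on T³ is a ladder rung (R3), NOT the Clay problem; nothing here claims the stub, the crux, d = 4 or the mass gap.

THE PRINT.  [Balaban1985Variational] (47)–(49) p. 285 (`A = A′ − HD(A′)`, the Sect. C fixed point), (51) p. 286 «for A′ with values in 𝔤 the configuration D(A′) has values in 𝔤 also»,
(56) p. 286 ∕ (78) p. 290 (`C^{(2)}`, `HD₃ = HD − HC^{(2)}`), (80) p. 290, (84)–(89) pp. 290–291 (`W = W₁ + W₂ + W₃ + V₀-group`), Prop. 6 p. 295 (uniqueness);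
[Balaban1985BackgroundPropagators] p. 393 «The operators … are real».  THE LETTERS OF RECORD: (W) units word (W-X′) of the EX namer ★w2-19200 g6 (2026-08-28T19:50:28Z) — A-units,
`H̃ := H1f … Δx U₀` (the slot `Δx` kept GENERIC with its three rows; letter of record `DeltaPiSlotP` — EX namer WORD (9) 2026-08-28T23:58:13Z — instantiated in ✓`…WCurrentRealityAtRecordT3`), `C̃ U₀ := fun A′ ↦ (−I) • CmapTwS U₀ ((η·I) • ιA′)`,
`J := Jcur (bgOfCfg F K U₀)`, `Δ̃π` a letter with px14's sector-row shape, `(ρ₂, τ₂) := (rieszτ frobEquiv, tr)`.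

WHAT IS PROVED (sorry-free, no definition).
* §1 GENERIC CALCULUS [folklore]: ★`apply_eq_zero_of_eventually_const` (`HasFDerivAt f f′ x`, `f(x + t•v) = f x` for small `t` ⟹ `f′ v = 0`); for a Sect. C regime `Regime H 0 C …` of lit
  `B11Eq174Chart`: ★★`Emap_add_eq_of_translate` (`C(Y + z) = C Y` on the ball ⟹ `HD(A′ + z) = HD(A′)`, by uniqueness ✓`Regime.eq_solA`), ★★`fderiv_Emap_apply_eq_zero_of_translate`
  (`(HD)′(A′) z = 0` for every direction `z` along which `C` is invariant), `fderiv_C_apply_eq_zero_of_translate`, ★`fderiv_fderiv_C_apply_eq_zero_of_translate` (`D²C(0)(Y,z) = 0 =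
  D²C(0)(z,Y)`, analyticity at `0` by Osgood as in lit ✓`quadPart_mem`), ★`quadPart_add_smul_eq_of_translate` (`C^{(2)}(A′ + t•z) = C^{(2)}(A′)`), ★★`fderiv_E3_apply_eq_zero_of_translate`.
* §2 ★★★ **`W80_isHermitian_trace_zero_of_rows`** — the display's `hWR` text at the (W-X′) `Wf`, member level: at `U₀ ∈ 𝔘_k(ε₀)` in the windows `10⁹L²e ≤ 1`, `10¹²L³ε₀ ≤ 1`, every
  Hermitian-traceless-valued `A′` with `‖A′‖ < a_C` has Hermitian-traceless-valued `W80 … A′`, GIVEN (displayed) `RC : Regime H̃ 0 C̃ bH 0 C₂ c₄ 0 aC εC` (px14 ✓`Prop7SectET3WChartConj`'s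
  binder; its `norm_G` is the display's `norm_H₁`), `hP4 : Prop4Hyp C̃ C₂ c₄` (px3 g2 ✓`Prop7SectET3WCurrentProp4Rows` shape), `c₄ ≤ e`, `hΔπ` (px14's `currentCLM_slot_isHermitian_traceless`
  shape), `hZC` = (Z-C) CENTRAL INVARIANCE of `C̃` in translate form, `hV0` = (R-V₀); DISCHARGED inside: `hH` (✓`Prop7HfRealityTrace.H1f_isHermitian_traceless_at_regPr`), `hC`
  (✓`Prop7SectET3WCurrentRealityLetters.Ctilde_isHermitian_trace_zero_of_ball`), `hJ` (✓`Prop7SectET3JcurReality.isHermitian_trace_zero_Jcur_bgOfCfg`), `hτS hτZ hρ` (letters file §2),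
  and `hDZ hD3Z` («central directions stay central» — here: are KILLED, §1).
HONEST SCOPE.  A door: `RC hP4 hΔπ hZC hV0` stay DISPLAYED ((Z-C) = located chart brick: `avgFunGL = expUnit(meanLog loops)·straight` picks up central scalars linearly, so the remainder is
centrally invariant — not typed here; (R-V₀) = located storey: the explicit (90)–(96) current at d = 3, where lit's (63) certificate `bondPair_curV0` (`4 ≤ d`) is unavailable); no estimate;
nothing of [Balaban1985Variational] Props 3–4 or [Balaban1985BackgroundPropagators] is asserted; the EX stub is not touched.

References: T. Bałaban, CMP **102** (1985) 277–309 [Balaban1985Variational] ((44)–(49) p.285, (51)–(52) p.286, (56) p.286, (78)–(80) p.290, (84)–(89) pp.290–291, Prop. 4 p.292,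
Prop. 6 p.295, (115) p.294); CMP **99** (1985) 389–434 [Balaban1985BackgroundPropagators] (p.393).
-/

set_option autoImplicit false

noncomputable section

open scoped InnerProductSpace ComplexConjugate Matrix.Norms.L2Operator BigOperators
open Metric Set Filter Topology

namespace Summit.QuantumFields.YangMills.Theorems.Prop7SectET3WCurrentReality

open Literature.MathematicalPhysics.QuantumFieldTheory.Balaban1983to89
open Literature.MathematicalPhysics.QuantumFieldTheory.Balaban1983to89.T3ContinuumYM3Torus
open T3SectALandauChart (eta eta_pos)
open T3PrintedRegularMinimiser (RegPr)
open B9SectCLatticeCarrier (Bond)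
open B11Eq115Space (NegSup NegSize Space115 JetSup levWeight)
open B11Eq111FrakG (nabla115)
open B11Eq174Chart (Regime)
open B11Prop6Scheme (Prop4Hyp mapT mapT_noLinear)
open B11Eq80Current (Emap E3 quadPart W80)
open B11Eq90V0GroupComposed (curV0full)
open B11Eq98CurrentSlot (Jcur)
open B11Eq98V0primeCurrentSlots (rieszτ)
open B11Eq80CurrentRealSubspace (W80_apply_mem)
open Summit.QuantumFields.YangMills.Theorems.Prop7SectET3Transport (periodsT3 siteEquiv bondEquiv bgOfCfg)
open Summit.QuantumFields.YangMills.Theorems.Prop7SectET3HilbertLetters (W₂ frobEquiv toL2)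
open Summit.QuantumFields.YangMills.Theorems.Prop7SectET3CurvedPropagators (H1f)
open Summit.QuantumFields.YangMills.Theorems.Prop7SymAvgTwSym (CmapTwS)
open Summit.QuantumFields.YangMills.Theorems.Prop7HfRealityTrace (H1f_isHermitian_traceless_at_regPr)
open Summit.QuantumFields.YangMills.Theorems.Prop7SectET3JcurReality (isHermitian_trace_zero_Jcur_bgOfCfg)
open Summit.QuantumFields.YangMills.Theorems.Prop7SectET3WCurrentRealityLetters (hτS_trace hτZ_trace hρ_rieszτ_frobEquiv Ctilde_isHermitian_trace_zero_of_ball)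

/-! ## §1 Generic calculus: a derivative kills every direction along which the map is locally constant; the Sect. C fixed point inherits the chart's central invariance -/

section Calculus

variable {E G : Type*} [NormedAddCommGroup E] [NormedSpace ℂ E] [NormedAddCommGroup G] [NormedSpace ℂ G]

/-- ★ **A DERIVATIVE KILLS A DIRECTION ALONG WHICH THE MAP IS LOCALLY CONSTANT**: `HasFDerivAt f f′ x` and `f(x + t•v) = f x` for small `t` give `f′ v = 0`. [folklore] -/
theorem apply_eq_zero_of_eventually_const {f : E → G} {f' : E →L[ℂ] G} {x v : E} (hf : HasFDerivAt f f' x)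
    (hc : ∀ᶠ t : ℂ in 𝓝 0, f (x + t • v) = f x) : f' v = 0 := by
  have h1 : HasDerivAt (fun t : ℂ => x + t • v) v 0 := by
    simpa using ((hasDerivAt_id (0 : ℂ)).smul_const v).const_add x
  have hline : HasDerivAt (fun t : ℂ => f (x + t • v)) (f' v) 0 :=
    hf.comp_hasDerivAt_of_eq (0 : ℂ) h1 (by simp)
  have hconst : HasDerivAt (fun t : ℂ => f (x + t • v)) 0 0 :=
    (hasDerivAt_const (0 : ℂ) (f x)).congr_of_eventuallyEq hc
  exact hline.unique hconst

end Calculus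

section FixedPoint

variable {𝔸 : Type*} [NormedRing 𝔸] [NormedAlgebra ℂ 𝔸] [FiniteDimensional ℂ 𝔸]
variable {d : ℕ} {Pd : Fin d → ℕ} {L η : ℝ} [Fact (0 < L)] [Fact (0 < η)] {lev₀ : Bond d Pd → ℕ} {κ' : Type*} [Fintype κ']
  {lev₁ : κ' → ℕ} {Dc : (Bond d Pd → 𝔸) →ₗ[ℂ] (κ' → 𝔸)}
variable {𝒳 : Type*} [NormedAddCommGroup 𝒳] [NormedSpace ℂ 𝒳] [CompleteSpace 𝒳]
variable {H : 𝒳 →L[ℂ] Space115 L η lev₀ lev₁ Dc} {C : Space115 L η lev₀ lev₁ Dc → 𝒳} {bH C₂ c₄ aC εC : ℝ}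

omit [CompleteSpace 𝒳] in
/-- ★★ **THE Sect. C FIXED POINT INHERITS A TRANSLATION INVARIANCE OF THE CHART**: if `C(Y + z) = C Y` on the ball `‖Y‖ < c₄` then `HD(A′ + z) = HD(A′)` whenever both data lie in the ball
`‖·‖ < a_C` (the solution for `A′` solves the equation for `A′ + z`; uniqueness, lit ✓`Regime.eq_solA`). [cite: Balaban1985Variational, (47)–(49) p.285, (52) p.286, Prop. 6 p.295] -/
theorem Emap_add_eq_of_translate (RC : Regime H 0 C bH 0 C₂ c₄ 0 aC εC) {z : Space115 L η lev₀ lev₁ Dc}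
    (hCz : ∀ Y : Space115 L η lev₀ lev₁ Dc, ‖Y‖ < c₄ → C (Y + z) = C Y)
    {A' : Space115 L η lev₀ lev₁ Dc} (hA' : ‖A'‖ < aC) (hA'z : ‖A' + z‖ < aC) : Emap H C εC (A' + z) = Emap H C εC A' := by
  obtain ⟨hXn, hfix⟩ := RC.solA_mem (J := (0 : 𝒳)) (by simp) hA'
  have hdom : ‖B11Eq174Chart.solA H 0 C 0 εC A' + A'‖ < c₄ := by
    have h1 : ‖B11Eq174Chart.solA H 0 C 0 εC A' + A'‖ < εC + aC := by linarith [norm_add_le (B11Eq174Chart.solA H 0 C 0 εC A') A']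
    have h2 : 0 < εC + aC := by linarith [RC.ε₄_nonneg, norm_nonneg A']
    linarith [RC.dom]
  have hfix' : mapT H 0 C 0 (A' + z) (B11Eq174Chart.solA H 0 C 0 εC A') = B11Eq174Chart.solA H 0 C 0 εC A' := by
    rw [mapT_noLinear] at hfix ⊢
    rw [← add_assoc, hCz _ hdom]
    exact hfix
  have huniq := RC.eq_solA (J := (0 : 𝒳)) (by simp) hA'z hXn hfix'
  show -B11Eq174Chart.solA H 0 C 0 εC (A' + z) = -B11Eq174Chart.solA H 0 C 0 εC A'
  rw [← huniq]

omit [CompleteSpace 𝒳] in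
/-- ★★ **`(HD)′(A′)` KILLS EVERY DIRECTION `z` ALONG WHICH THE CHART IS INVARIANT NEAR THE BALL**: `C(Y + t•z) = C Y` for `‖Y‖ < c₄`, `‖t‖ < δ` ⟹ `fderiv (HD) A′ z = 0` on `‖A′‖ < a_C`.
[cite: Balaban1985Variational, (47)–(49) p.285, (51) p.286, Prop. 6 p.295] -/
theorem fderiv_Emap_apply_eq_zero_of_translate (RC : Regime H 0 C bH 0 C₂ c₄ 0 aC εC) (hP4 : Prop4Hyp C C₂ c₄) {z : Space115 L η lev₀ lev₁ Dc} {δ : ℝ} (hδ : 0 < δ)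
    (hCz : ∀ Y : Space115 L η lev₀ lev₁ Dc, ‖Y‖ < c₄ → ∀ t : ℂ, ‖t‖ < δ → C (Y + t • z) = C Y)
    {A' : Space115 L η lev₀ lev₁ Dc} (hA' : ‖A'‖ < aC) : fderiv ℂ (Emap H C εC) A' z = 0 := by
  have hdiff : HasFDerivAt (Emap H C εC) (fderiv ℂ (Emap H C εC) A') A' :=
    ((B11Eq80Current.analyticOnNhd_Emap RC hP4 A' (by simpa using hA')).differentiableAt).hasFDerivAt
  refine apply_eq_zero_of_eventually_const hdiff ?_
  -- for small `t`, both data lie in the ball and the chart is invariant under `t•z`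
  have hgap : 0 < aC - ‖A'‖ := by linarith
  have hr : 0 < min δ ((aC - ‖A'‖) / (‖z‖ + 1)) := lt_min hδ (div_pos hgap (by positivity))
  filter_upwards [Metric.ball_mem_nhds (0 : ℂ) hr] with t ht
  rw [Metric.mem_ball, dist_zero_right, lt_min_iff] at ht
  have htz : ‖t • z‖ < aC - ‖A'‖ := by
    rw [norm_smul]
    calc ‖t‖ * ‖z‖ ≤ ‖t‖ * (‖z‖ + 1) := mul_le_mul_of_nonneg_left (by linarith) (norm_nonneg t)
      _ < (aC - ‖A'‖) / (‖z‖ + 1) * (‖z‖ + 1) := mul_lt_mul_of_pos_right ht.2 (by positivity)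
      _ = aC - ‖A'‖ := div_mul_cancel₀ _ (by positivity)
  have hA'z : ‖A' + t • z‖ < aC := by linarith [norm_add_le A' (t • z)]
  exact Emap_add_eq_of_translate RC (fun Y hY => hCz Y hY t ht.1) hA' hA'z

omit [FiniteDimensional ℂ 𝔸] [CompleteSpace 𝒳] in
/-- `fderiv C y z = 0` at every point of the ball, for an invariant direction `z` (lit `Prop4Hyp`'s differentiability on the ball). [cite: Balaban1985Variational, (51) p.286, Prop. 4 p.292] -/
theorem fderiv_C_apply_eq_zero_of_translate (hP4 : Prop4Hyp C C₂ c₄) {z : Space115 L η lev₀ lev₁ Dc} {δ : ℝ} (hδ : 0 < δ)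
    (hCz : ∀ Y : Space115 L η lev₀ lev₁ Dc, ‖Y‖ < c₄ → ∀ t : ℂ, ‖t‖ < δ → C (Y + t • z) = C Y)
    {y : Space115 L η lev₀ lev₁ Dc} (hy : ‖y‖ < c₄) : fderiv ℂ C y z = 0 := by
  have hopen : IsOpen {Y : Space115 L η lev₀ lev₁ Dc | ‖Y‖ < c₄} := isOpen_lt continuous_norm continuous_const
  have hdiff : HasFDerivAt C (fderiv ℂ C y) y := (hP4.differentiableOn.differentiableAt (hopen.mem_nhds hy)).hasFDerivAt
  refine apply_eq_zero_of_eventually_const hdiff ?_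
  filter_upwards [Metric.ball_mem_nhds (0 : ℂ) hδ] with t ht
  rw [Metric.mem_ball, dist_zero_right] at ht
  exact hCz y hy t ht

/-- ★ **THE SECOND DERIVATIVE AT `0` KILLS AN INVARIANT DIRECTION IN EITHER SLOT**: `D²C(0)(Y, z) = 0` and `D²C(0)(z, Y) = 0` (`0 < c₄`; `C` analytic on the ball via Osgood as in lit
✓`quadPart_mem`). [cite: Balaban1985Variational, (56) p.286, (78) p.290, (51) p.286] -/
theorem fderiv_fderiv_C_apply_eq_zero_of_translate (hP4 : Prop4Hyp C C₂ c₄) (hc₄ : 0 < c₄) {z : Space115 L η lev₀ lev₁ Dc} {δ : ℝ} (hδ : 0 < δ)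
    (hCz : ∀ Y : Space115 L η lev₀ lev₁ Dc, ‖Y‖ < c₄ → ∀ t : ℂ, ‖t‖ < δ → C (Y + t • z) = C Y) (Y : Space115 L η lev₀ lev₁ Dc) :
    (fderiv ℂ (fderiv ℂ C) 0 Y) z = 0 ∧ (fderiv ℂ (fderiv ℂ C) 0 z) Y = 0 := by
  have hopen : IsOpen {Y : Space115 L η lev₀ lev₁ Dc | ‖Y‖ < c₄} := isOpen_lt continuous_norm continuous_const
  have hA0 : AnalyticAt ℂ C 0 :=
    Literature.Analysis.Complex.SCV.analyticOnNhd_of_differentiableOn hP4.differentiableOn hopen 0 (by simpa using hc₄)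
  have hdiff2 : DifferentiableAt ℂ (fderiv ℂ C) 0 :=
    ((hA0.contDiffAt (n := 2)).fderiv_right (m := 1) le_rfl).differentiableAt one_ne_zero
  have hball : ∀ᶠ y in 𝓝 (0 : Space115 L η lev₀ lev₁ Dc), ‖y‖ < c₄ := hopen.mem_nhds (by simpa using hc₄)
  refine ⟨?_, ?_⟩
  · -- `y ↦ fderiv C y z` vanishes near `0`, so its derivative at `0` — `Y ↦ D²C(0)(Y, z)` — vanishes
    have hφ : (fun y => fderiv ℂ C y z) =ᶠ[𝓝 0] fun _ => (0 : 𝒳) := by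
      filter_upwards [hball] with y hy
      exact fderiv_C_apply_eq_zero_of_translate hP4 hδ hCz hy
    have hcomp : HasFDerivAt (fun y => fderiv ℂ C y z) ((ContinuousLinearMap.apply ℂ 𝒳 z).comp (fderiv ℂ (fderiv ℂ C) 0)) 0 :=
      (ContinuousLinearMap.apply ℂ 𝒳 z).hasFDerivAt.comp 0 hdiff2.hasFDerivAt
    have h0 : HasFDerivAt (fun y : Space115 L η lev₀ lev₁ Dc => fderiv ℂ C y z) (0 : Space115 L η lev₀ lev₁ Dc →L[ℂ] 𝒳) 0 :=
      (hasFDerivAt_const (0 : 𝒳) (0 : Space115 L η lev₀ lev₁ Dc)).congr_of_eventuallyEq hφ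
    have := hcomp.unique h0
    have hY := congrArg (fun T : Space115 L η lev₀ lev₁ Dc →L[ℂ] 𝒳 => T Y) this
    simpa using hY
  · -- `t ↦ fderiv C (t•z)` is constant near `0` (the chart and its `t•z`-translate agree near `0`), so `D²C(0)(z, ·) = 0`
    have hc : ∀ᶠ t : ℂ in 𝓝 0, fderiv ℂ C (0 + t • z) = fderiv ℂ C 0 := by
      have hr : 0 < min δ (c₄ / (‖z‖ + 1)) := lt_min hδ (div_pos hc₄ (by positivity))
      filter_upwards [Metric.ball_mem_nhds (0 : ℂ) hr] with t ht
      rw [Metric.mem_ball, dist_zero_right, lt_min_iff] at ht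
      rw [zero_add]
      -- `C = C ∘ (· + t•z)` near `0`
      have hnear : (fun Y => C (Y + t • z)) =ᶠ[𝓝 0] C := by
        filter_upwards [hball] with Y hY
        exact hCz Y hY t ht.1
      rw [← hnear.fderiv_eq, fderiv_comp_add_right, zero_add]
    have key := apply_eq_zero_of_eventually_const hdiff2.hasFDerivAt hc
    have hY := congrArg (fun T : Space115 L η lev₀ lev₁ Dc →L[ℂ] 𝒳 => T Y) key
    simpa using hY

/-- ★ **`C^{(2)}` IS INVARIANT ALONG AN INVARIANT DIRECTION**: `quadPart C (A′ + t•z) = quadPart C A′` for all `t` (`quadPart C Y = ½·D²C(0)(Y,Y)` and both cross terms and the `zz`-term vanish).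
[cite: Balaban1985Variational, (56) p.286, (78) p.290, (51) p.286] -/
theorem quadPart_add_smul_eq_of_translate (hP4 : Prop4Hyp C C₂ c₄) (hc₄ : 0 < c₄) {z : Space115 L η lev₀ lev₁ Dc} {δ : ℝ} (hδ : 0 < δ)
    (hCz : ∀ Y : Space115 L η lev₀ lev₁ Dc, ‖Y‖ < c₄ → ∀ t : ℂ, ‖t‖ < δ → C (Y + t • z) = C Y) (A' : Space115 L η lev₀ lev₁ Dc) (t : ℂ) :
    quadPart C (A' + t • z) = quadPart C A' := by
  have h2 : ∀ W : Space115 L η lev₀ lev₁ Dc, iteratedFDeriv ℂ 2 C 0 (fun _ => W) = (fderiv ℂ (fderiv ℂ C) 0 W) W := fun W => iteratedFDeriv_two_apply C 0 _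
  obtain ⟨hYz, hzY⟩ := fderiv_fderiv_C_apply_eq_zero_of_translate hP4 hc₄ hδ hCz A'
  obtain ⟨hzz, -⟩ := fderiv_fderiv_C_apply_eq_zero_of_translate hP4 hc₄ hδ hCz z
  unfold quadPart
  rw [h2, h2]
  congr 1
  have hB : (fderiv ℂ (fderiv ℂ C) 0) (A' + t • z) = (fderiv ℂ (fderiv ℂ C) 0) A' + t • (fderiv ℂ (fderiv ℂ C) 0) z := by rw [map_add, map_smul]
  rw [hB, show (((fderiv ℂ (fderiv ℂ C) 0) A' + t • (fderiv ℂ (fderiv ℂ C) 0) z) : Space115 L η lev₀ lev₁ Dc →L[ℂ] 𝒳) (A' + t • z)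
      = ((fderiv ℂ (fderiv ℂ C) 0) A') (A' + t • z) + t • (((fderiv ℂ (fderiv ℂ C) 0) z) (A' + t • z)) from rfl,
    map_add, map_smul, hYz, smul_zero, add_zero, map_add, map_smul, hzY, hzz, smul_zero, add_zero, smul_zero, add_zero]

/-- ★★ **`(HD₃)′(A′)` KILLS EVERY INVARIANT DIRECTION**: `fderiv (HD₃) A′ z = 0` on `‖A′‖ < a_C` (`HD₃ = HD − H∘C^{(2)}`, both invariant along `z`).
[cite: Balaban1985Variational, (78) p.290, (85) p.291, (51) p.286] -/
theorem fderiv_E3_apply_eq_zero_of_translate (RC : Regime H 0 C bH 0 C₂ c₄ 0 aC εC) (hP4 : Prop4Hyp C C₂ c₄) {z : Space115 L η lev₀ lev₁ Dc} {δ : ℝ} (hδ : 0 < δ)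
    (hCz : ∀ Y : Space115 L η lev₀ lev₁ Dc, ‖Y‖ < c₄ → ∀ t : ℂ, ‖t‖ < δ → C (Y + t • z) = C Y)
    {A' : Space115 L η lev₀ lev₁ Dc} (hA' : ‖A'‖ < aC) : fderiv ℂ (E3 H C εC) A' z = 0 := by
  have hc₄ : 0 < c₄ := by linarith [RC.dom, RC.ε₄_nonneg, norm_nonneg A', hA']
  have hdiff : HasFDerivAt (E3 H C εC) (fderiv ℂ (E3 H C εC) A') A' :=
    ((B11Eq80Current.analyticOnNhd_E3 RC hP4 A' (by simpa using hA')).differentiableAt).hasFDerivAt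
  refine apply_eq_zero_of_eventually_const hdiff ?_
  have hgap : 0 < aC - ‖A'‖ := by linarith
  have hr : 0 < min δ ((aC - ‖A'‖) / (‖z‖ + 1)) := lt_min hδ (div_pos hgap (by positivity))
  filter_upwards [Metric.ball_mem_nhds (0 : ℂ) hr] with t ht
  rw [Metric.mem_ball, dist_zero_right, lt_min_iff] at ht
  have htz : ‖t • z‖ < aC - ‖A'‖ := by
    rw [norm_smul]
    calc ‖t‖ * ‖z‖ ≤ ‖t‖ * (‖z‖ + 1) := mul_le_mul_of_nonneg_left (by linarith) (norm_nonneg t)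
      _ < (aC - ‖A'‖) / (‖z‖ + 1) * (‖z‖ + 1) := mul_lt_mul_of_pos_right ht.2 (by positivity)
      _ = aC - ‖A'‖ := div_mul_cancel₀ _ (by positivity)
  have hA'z : ‖A' + t • z‖ < aC := by linarith [norm_add_le A' (t • z)]
  show Emap H C εC (A' + t • z) - H (quadPart C (A' + t • z)) = Emap H C εC A' - H (quadPart C A')
  rw [Emap_add_eq_of_translate RC (fun Y hY => hCz Y hY t ht.1) hA' hA'z, quadPart_add_smul_eq_of_translate hP4 hc₄ hδ hCz]

end FixedPoint


/-! ## §2 ★★★ The door: `hWR` at `Wf := W80 (rieszτ frobEquiv) tr (bgOfCfg F K U₀) (H1f…Δx…U₀) C̃ εC (Jcur (bgOfCfg F K U₀)) Δ̃π` from the displayed rows -/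

section Door

variable (F : T3Family) (n K : ℕ) (h : n ≤ K) (c₀ cB a : ℝ) [Fact (0 < c₀)] [Fact (0 < cB)] [Fact (0 < (F.L : ℝ))] [Fact (0 < ((F.L : ℝ)⁻¹) ^ (K - n))]

/-- ★★★ **THE EX DISPLAY'S ROW `hWR` AT THE (W-X′) LETTERS OF RECORD, FROM ITS LOCATED RESIDUE.**  At `U₀ ∈ 𝔘_k(ε₀)` in the windows `10⁹L²e ≤ 1`, `10¹²L³ε₀ ≤ 1`, for the current
`W(A′) := W80 ρ₂ τ₂ (bgOfCfg F K U₀) H̃ C̃ εC (Jcur (bgOfCfg F K U₀)) Δ̃π A′` with `ρ₂ := rieszτ frobEquiv`, `τ₂ := tr`, `H̃ := H1f … Δx U₀` (any symmetric real slot `Δx`: rows `hΔx hΔtr hΔsymm`),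
`C̃ := fun A′ ↦ (−I) • CmapTwS U₀ ((η·I) • ιA′)`: every Hermitian-traceless-valued `A′` with `‖A′‖ < a_C` has Hermitian-traceless-valued `W(A′)` — GIVEN the Sect. C regime `RC` of
`(H̃, C̃)` (its `norm_G` is the display's `norm_H₁`), `Prop4Hyp C̃` (px3 g2 ✓p664073's shape), `c₄ ≤ e`, the sector row `hΔπ` of the letter `Δ̃π` (px14's `currentCLM_slot_isHermitian_traceless`
shape), the CENTRAL INVARIANCE `hZC` of `C̃` in translate form (located brick (Z-C): `C̃(Y + z) = C̃ Y` for central `z`, `‖z‖ < δ`, on the ball `‖Y‖ < c₄`) and the sector row `hV0` of the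
V₀-group current (located storey (R-V₀)).  DISCHARGED inside: `hH` (✓`H1f_isHermitian_traceless_at_regPr`), `hC` (letters file §3), `hJ` (✓`isHermitian_trace_zero_Jcur_bgOfCfg`), the duality rows (letters file §2),
and BOTH scalar-sector rows `hDZ hD3Z` of lit ✓`W80_apply_mem` — `(HD)′(A′)z = 0 = (HD₃)′(A′)z` for central `z` (§1).  HONEST: a door; `RC hP4 hΔπ hZC hV0` stay displayed; nothing of
[Balaban1985Variational] Props 3–4 is asserted; the EX stub is not touched. [cite: Balaban1985Variational, (51) p.286, (80) p.290, (84)–(89) pp.290–291, (44)–(49) p.285; Balaban1985BackgroundPropagators, p.393] -/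
theorem W80_isHermitian_trace_zero_of_rows
    (Δx : GaugeField (F.P K) 0 (Matrix.specialUnitaryGroup (Fin 2) ℂ) → (B11Eq103H1Complex.BondL2K ℂ 3 (periodsT3 F K) c₀ W₂ →ₗ[ℂ] B11Eq103H1Complex.BondL2K ℂ 3 (periodsT3 F K) c₀ W₂))
    {ε₀ e : ℝ} (hε₀ : 0 < ε₀) (he : 0 < e) (hWe : 10 ^ 9 * (F.L : ℝ) ^ 2 * e ≤ 1) (hWε : 10 ^ 12 * (F.L : ℝ) ^ 3 * ε₀ ≤ 1)
    (U₀ : GaugeField (F.P K) 0 (Matrix.specialUnitaryGroup (Fin 2) ℂ)) (hreg : RegPr F n K ε₀ U₀)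
    -- the slot's three rows (record: `DeltaPiSlotP`, ✓p669809 by name; also ✓ at `DeltaEtaSlot` ∕ `DeltaOnePJ`)
    (hΔx : ∀ f : B11Eq103H1Complex.BondL2K ℂ 3 (periodsT3 F K) c₀ W₂, Δx U₀ (toL2 F K c₀ (star ((toL2 F K c₀).symm f))) = toL2 F K c₀ (star ((toL2 F K c₀).symm (Δx U₀ f))))
    (hΔtr : ∀ A : PBond (F.P K) 0 → Matrix (Fin 2) (Fin 2) ℂ, (∀ b, (A b).trace = 0) → ∀ b, ((toL2 F K c₀).symm (Δx U₀ (toL2 F K c₀ A)) b).trace = 0)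
    (hΔsymm : (Δx U₀).IsSymmetric)
    -- the Sect. C regime of `(H̃, C̃)` and Prop. 4 for `C̃` (DISPLAYED; px14 ✓`…WChartConjT3` binder ∕ px3 g2 ✓p664073 shape), with `c₄ ≤ e`
    {bH C₂ c₄ aC εC : ℝ}
    (RC : Regime (H1f F n K h c₀ cB a Δx U₀) 0
      (fun A' : Space115 (F.L : ℝ) (((F.L : ℝ)⁻¹) ^ (K - n)) (fun _ : Bond 3 (periodsT3 F K) => K - n)
        (fun _ : Bond 3 (periodsT3 F K) × Fin 3 => K - n) (nabla115 (((F.L : ℝ)⁻¹) ^ (K - n)) (bgOfCfg F K U₀)) =>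
          (-Complex.I) • CmapTwS F n K h U₀ (((((eta F n K : ℝ) : ℂ)) * Complex.I) • fun b : PBond (F.P K) 0 => JetSup.equiv _ _ _ A' (bondEquiv F K b)))
      bH 0 C₂ c₄ 0 aC εC)
    (hP4 : Prop4Hyp (fun A' : Space115 (F.L : ℝ) (((F.L : ℝ)⁻¹) ^ (K - n)) (fun _ : Bond 3 (periodsT3 F K) => K - n)
        (fun _ : Bond 3 (periodsT3 F K) × Fin 3 => K - n) (nabla115 (((F.L : ℝ)⁻¹) ^ (K - n)) (bgOfCfg F K U₀)) =>
          (-Complex.I) • CmapTwS F n K h U₀ (((((eta F n K : ℝ) : ℂ)) * Complex.I) • fun b : PBond (F.P K) 0 => JetSup.equiv _ _ _ A' (bondEquiv F K b))) C₂ c₄)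
    (hc₄e : c₄ ≤ e)
    -- the letter `Δ̃π` with its sector row (px14's `currentCLM_slot_isHermitian_traceless` shape; DISPLAYED)
    (Δπ : Space115 (F.L : ℝ) (((F.L : ℝ)⁻¹) ^ (K - n)) (fun _ : Bond 3 (periodsT3 F K) => K - n)
        (fun _ : Bond 3 (periodsT3 F K) × Fin 3 => K - n) (nabla115 (((F.L : ℝ)⁻¹) ^ (K - n)) (bgOfCfg F K U₀)) →L[ℂ]
      NegSize (F.L : ℝ) (((F.L : ℝ)⁻¹) ^ (K - n)) (fun _ : Bond 3 (periodsT3 F K) => K - n) 3 (Matrix (Fin 2) (Fin 2) ℂ))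
    (hΔπ : ∀ Y : Space115 (F.L : ℝ) (((F.L : ℝ)⁻¹) ^ (K - n)) (fun _ : Bond 3 (periodsT3 F K) => K - n)
        (fun _ : Bond 3 (periodsT3 F K) × Fin 3 => K - n) (nabla115 (((F.L : ℝ)⁻¹) ^ (K - n)) (bgOfCfg F K U₀)),
      (∀ b, (JetSup.equiv _ _ _ Y b).IsHermitian ∧ (JetSup.equiv _ _ _ Y b).trace = 0) →
      ∀ b, (NegSup.equiv _ _ (Δπ Y) b).IsHermitian ∧ (NegSup.equiv _ _ (Δπ Y) b).trace = 0)
    -- (Z-C) CENTRAL INVARIANCE OF THE CHART, translate form (DISPLAYED — located brick, chart lineage)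
    {δ : ℝ} (hδ : 0 < δ)
    (hZC : ∀ Y : Space115 (F.L : ℝ) (((F.L : ℝ)⁻¹) ^ (K - n)) (fun _ : Bond 3 (periodsT3 F K) => K - n)
        (fun _ : Bond 3 (periodsT3 F K) × Fin 3 => K - n) (nabla115 (((F.L : ℝ)⁻¹) ^ (K - n)) (bgOfCfg F K U₀)), ‖Y‖ < c₄ →
      ∀ z : Space115 (F.L : ℝ) (((F.L : ℝ)⁻¹) ^ (K - n)) (fun _ : Bond 3 (periodsT3 F K) => K - n)
        (fun _ : Bond 3 (periodsT3 F K) × Fin 3 => K - n) (nabla115 (((F.L : ℝ)⁻¹) ^ (K - n)) (bgOfCfg F K U₀)),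
        (∀ b, ∃ c : ℂ, JetSup.equiv _ _ _ z b = c • (1 : Matrix (Fin 2) (Fin 2) ℂ)) → ‖z‖ < δ →
        (-Complex.I) • CmapTwS F n K h U₀ (((((eta F n K : ℝ) : ℂ)) * Complex.I) • fun b : PBond (F.P K) 0 => JetSup.equiv _ _ _ (Y + z) (bondEquiv F K b))
          = (-Complex.I) • CmapTwS F n K h U₀ (((((eta F n K : ℝ) : ℂ)) * Complex.I) • fun b : PBond (F.P K) 0 => JetSup.equiv _ _ _ Y (bondEquiv F K b)))
    -- (R-V₀) the sector row of the V₀-group current (DISPLAYED — located storey)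
    (hV0 : ∀ A' : Space115 (F.L : ℝ) (((F.L : ℝ)⁻¹) ^ (K - n)) (fun _ : Bond 3 (periodsT3 F K) => K - n)
        (fun _ : Bond 3 (periodsT3 F K) × Fin 3 => K - n) (nabla115 (((F.L : ℝ)⁻¹) ^ (K - n)) (bgOfCfg F K U₀)), ‖A'‖ < aC →
      (∀ b, (JetSup.equiv _ _ _ A' b).IsHermitian ∧ (JetSup.equiv _ _ _ A' b).trace = 0) →
      ∀ b, (NegSup.equiv _ _ (curV0full (rieszτ frobEquiv) (LinearMap.toContinuousLinearMap (Matrix.traceLinearMap (Fin 2) ℂ ℂ)) (bgOfCfg F K U₀)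
          (H1f F n K h c₀ cB a Δx U₀)
          (fun A' : Space115 (F.L : ℝ) (((F.L : ℝ)⁻¹) ^ (K - n)) (fun _ : Bond 3 (periodsT3 F K) => K - n)
            (fun _ : Bond 3 (periodsT3 F K) × Fin 3 => K - n) (nabla115 (((F.L : ℝ)⁻¹) ^ (K - n)) (bgOfCfg F K U₀)) =>
              (-Complex.I) • CmapTwS F n K h U₀ (((((eta F n K : ℝ) : ℂ)) * Complex.I) • fun b : PBond (F.P K) 0 => JetSup.equiv _ _ _ A' (bondEquiv F K b)))
          εC A') b).IsHermitian ∧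
        (NegSup.equiv _ _ (curV0full (rieszτ frobEquiv) (LinearMap.toContinuousLinearMap (Matrix.traceLinearMap (Fin 2) ℂ ℂ)) (bgOfCfg F K U₀)
          (H1f F n K h c₀ cB a Δx U₀)
          (fun A' : Space115 (F.L : ℝ) (((F.L : ℝ)⁻¹) ^ (K - n)) (fun _ : Bond 3 (periodsT3 F K) => K - n)
            (fun _ : Bond 3 (periodsT3 F K) × Fin 3 => K - n) (nabla115 (((F.L : ℝ)⁻¹) ^ (K - n)) (bgOfCfg F K U₀)) =>
              (-Complex.I) • CmapTwS F n K h U₀ (((((eta F n K : ℝ) : ℂ)) * Complex.I) • fun b : PBond (F.P K) 0 => JetSup.equiv _ _ _ A' (bondEquiv F K b)))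
          εC A') b).trace = 0)
    -- the datum
    (A' : Space115 (F.L : ℝ) (((F.L : ℝ)⁻¹) ^ (K - n)) (fun _ : Bond 3 (periodsT3 F K) => K - n)
      (fun _ : Bond 3 (periodsT3 F K) × Fin 3 => K - n) (nabla115 (((F.L : ℝ)⁻¹) ^ (K - n)) (bgOfCfg F K U₀)))
    (hA' : ‖A'‖ < aC) (hA'S : ∀ b, (JetSup.equiv _ _ _ A' b).IsHermitian ∧ (JetSup.equiv _ _ _ A' b).trace = 0) (b : Bond 3 (periodsT3 F K)) :
    (NegSup.equiv _ _ (W80 (rieszτ frobEquiv) (LinearMap.toContinuousLinearMap (Matrix.traceLinearMap (Fin 2) ℂ ℂ)) (bgOfCfg F K U₀) (H1f F n K h c₀ cB a Δx U₀)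
        (fun A' : Space115 (F.L : ℝ) (((F.L : ℝ)⁻¹) ^ (K - n)) (fun _ : Bond 3 (periodsT3 F K) => K - n)
          (fun _ : Bond 3 (periodsT3 F K) × Fin 3 => K - n) (nabla115 (((F.L : ℝ)⁻¹) ^ (K - n)) (bgOfCfg F K U₀)) =>
            (-Complex.I) • CmapTwS F n K h U₀ (((((eta F n K : ℝ) : ℂ)) * Complex.I) • fun b : PBond (F.P K) 0 => JetSup.equiv _ _ _ A' (bondEquiv F K b)))
        εC (Jcur (bgOfCfg F K U₀)) Δπ A') b).IsHermitian ∧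
    (NegSup.equiv _ _ (W80 (rieszτ frobEquiv) (LinearMap.toContinuousLinearMap (Matrix.traceLinearMap (Fin 2) ℂ ℂ)) (bgOfCfg F K U₀) (H1f F n K h c₀ cB a Δx U₀)
        (fun A' : Space115 (F.L : ℝ) (((F.L : ℝ)⁻¹) ^ (K - n)) (fun _ : Bond 3 (periodsT3 F K) => K - n)
          (fun _ : Bond 3 (periodsT3 F K) × Fin 3 => K - n) (nabla115 (((F.L : ℝ)⁻¹) ^ (K - n)) (bgOfCfg F K U₀)) =>
            (-Complex.I) • CmapTwS F n K h U₀ (((((eta F n K : ℝ) : ℂ)) * Complex.I) • fun b : PBond (F.P K) 0 => JetSup.equiv _ _ _ A' (bondEquiv F K b)))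
        εC (Jcur (bgOfCfg F K U₀)) Δπ A') b).trace = 0 := by
  -- the three real sectors
  let S : Submodule ℝ (Matrix (Fin 2) (Fin 2) ℂ) :=
    { carrier := {X | X.IsHermitian ∧ X.trace = 0}
      add_mem' := fun {X Y} hX hY => ⟨hX.1.add hY.1, by rw [Matrix.trace_add, hX.2, hY.2, add_zero]⟩
      zero_mem' := ⟨Matrix.isHermitian_zero, Matrix.trace_zero _ _⟩
      smul_mem' := fun r X hX => ⟨by
          rw [Matrix.IsHermitian, Matrix.conjTranspose_smul, star_trivial, hX.1.eq],
        by rw [Matrix.trace_smul, hX.2, smul_zero]⟩ }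
  let Z : Submodule ℝ (Matrix (Fin 2) (Fin 2) ℂ) :=
    { carrier := {X | ∃ c : ℂ, X = c • (1 : Matrix (Fin 2) (Fin 2) ℂ)}
      add_mem' := fun {X Y} hX hY => by
        obtain ⟨c, rfl⟩ := hX; obtain ⟨d, rfl⟩ := hY
        exact ⟨c + d, (add_smul c d _).symm⟩
      zero_mem' := ⟨0, (zero_smul ℂ _).symm⟩
      smul_mem' := fun r X hX => by
        obtain ⟨c, rfl⟩ := hX
        exact ⟨r • c, (smul_assoc r c (1 : Matrix (Fin 2) (Fin 2) ℂ)).symm⟩ }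
  let SX : Submodule ℝ (PBond (F.P n) 0 → Matrix (Fin 2) (Fin 2) ℂ) :=
    { carrier := {B | ∀ c, (B c).IsHermitian ∧ (B c).trace = 0}
      add_mem' := fun {X Y} hX hY c => ⟨(hX c).1.add (hY c).1, by rw [Pi.add_apply, Matrix.trace_add, (hX c).2, (hY c).2, add_zero]⟩
      zero_mem' := fun c => ⟨Matrix.isHermitian_zero, Matrix.trace_zero _ _⟩
      smul_mem' := fun r X hX c => ⟨by
          rw [Pi.smul_apply, Matrix.IsHermitian, Matrix.conjTranspose_smul, star_trivial, (hX c).1.eq],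
        by rw [Pi.smul_apply, Matrix.trace_smul, (hX c).2, smul_zero]⟩ }
  have hS : ∀ X : Matrix (Fin 2) (Fin 2) ℂ, X ∈ S ↔ X.IsHermitian ∧ X.trace = 0 := fun X => Iff.rfl
  have hZ : ∀ X : Matrix (Fin 2) (Fin 2) ℂ, X ∈ Z ↔ ∃ c : ℂ, X = c • (1 : Matrix (Fin 2) (Fin 2) ℂ) := fun X => Iff.rfl
  have hSXc : IsClosed (SX : Set (PBond (F.P n) 0 → Matrix (Fin 2) (Fin 2) ℂ)) := SX.closed_of_finiteDimensional
  -- the scalar-sector rows from (Z-C): central directions are KILLED by `(HD)′(A′)` and `(HD₃)′(A′)`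
  have central_lines : ∀ z : Space115 (F.L : ℝ) (((F.L : ℝ)⁻¹) ^ (K - n)) (fun _ : Bond 3 (periodsT3 F K) => K - n)
      (fun _ : Bond 3 (periodsT3 F K) × Fin 3 => K - n) (nabla115 (((F.L : ℝ)⁻¹) ^ (K - n)) (bgOfCfg F K U₀)),
      (∀ b, JetSup.equiv _ _ _ z b ∈ Z) →
      ∀ Y : Space115 (F.L : ℝ) (((F.L : ℝ)⁻¹) ^ (K - n)) (fun _ : Bond 3 (periodsT3 F K) => K - n)
        (fun _ : Bond 3 (periodsT3 F K) × Fin 3 => K - n) (nabla115 (((F.L : ℝ)⁻¹) ^ (K - n)) (bgOfCfg F K U₀)), ‖Y‖ < c₄ →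
        ∀ t : ℂ, ‖t‖ < δ / (‖z‖ + 1) →
          (-Complex.I) • CmapTwS F n K h U₀ (((((eta F n K : ℝ) : ℂ)) * Complex.I) • fun b : PBond (F.P K) 0 => JetSup.equiv _ _ _ (Y + t • z) (bondEquiv F K b))
            = (-Complex.I) • CmapTwS F n K h U₀ (((((eta F n K : ℝ) : ℂ)) * Complex.I) • fun b : PBond (F.P K) 0 => JetSup.equiv _ _ _ Y (bondEquiv F K b)) := by
    intro z hz Y hY t ht
    refine hZC Y hY (t • z) (fun b' => ?_) ?_
    · obtain ⟨c, hc⟩ := hz b'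
      exact ⟨t * c, by rw [JetSup.equiv_smul, Pi.smul_apply, hc, smul_smul]⟩
    · rw [norm_smul]
      have hz1 : 0 < ‖z‖ + 1 := by positivity
      calc ‖t‖ * ‖z‖ ≤ ‖t‖ * (‖z‖ + 1) := mul_le_mul_of_nonneg_left (by linarith) (norm_nonneg t)
        _ < δ / (‖z‖ + 1) * (‖z‖ + 1) := mul_lt_mul_of_pos_right ht hz1
        _ = δ := div_mul_cancel₀ _ hz1.ne'
  have hδz : ∀ z : Space115 (F.L : ℝ) (((F.L : ℝ)⁻¹) ^ (K - n)) (fun _ : Bond 3 (periodsT3 F K) => K - n)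
      (fun _ : Bond 3 (periodsT3 F K) × Fin 3 => K - n) (nabla115 (((F.L : ℝ)⁻¹) ^ (K - n)) (bgOfCfg F K U₀)), 0 < δ / (‖z‖ + 1) := fun z =>
    div_pos hδ (by positivity)
  refine W80_apply_mem RC hP4 S Z SX (rieszτ frobEquiv) (LinearMap.toContinuousLinearMap (Matrix.traceLinearMap (Fin 2) ℂ ℂ)) (hτS_trace S hS) (hτZ_trace S Z hS hZ)
    (hρ_rieszτ_frobEquiv S Z hS hZ) (fun Y hY hYS c => Ctilde_isHermitian_trace_zero_of_ball F h hε₀ he hWe hWε hc₄e U₀ hreg Y hY hYS c)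
    (fun X hX b' => H1f_isHermitian_traceless_at_regPr F n K h c₀ cB a Δx hε₀ he hWe hWε U₀ hreg hΔx hΔtr hΔsymm X hX b') hSXc (bgOfCfg F K U₀)
    (Jcur (bgOfCfg F K U₀)) (fun b' => isHermitian_trace_zero_Jcur_bgOfCfg (n := n) U₀ b') Δπ hΔπ hA' hA'S (fun z hz b' => ?_) (fun z hz b' => ?_) (hV0 A' hA' hA'S) b
  · rw [fderiv_Emap_apply_eq_zero_of_translate RC hP4 (hδz z) (central_lines z hz) hA', JetSup.equiv_zero, Pi.zero_apply]
    exact ⟨0, (zero_smul ℂ _).symm⟩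
  · rw [fderiv_E3_apply_eq_zero_of_translate RC hP4 (hδz z) (central_lines z hz) hA', JetSup.equiv_zero, Pi.zero_apply]
    exact ⟨0, (zero_smul ℂ _).symm⟩

end Door

end Summit.QuantumFields.YangMills.Theorems.Prop7SectET3WCurrentReality

end
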